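import Mathlib
import HarnessLib
import Literature.NumberTheory.LFunctions.ZetaScrew
import Summits.RiemannHypothesis.RiemannHypothesis.Theorems.IntegerScrewIncrementCovariance

/-!
# Route `IntegerScrew` — adjacent increments of the screw line are NEGATIVELY correlated (M ≥ 60)

Corollary of `IntegerScrewIncrementCovariance.abs_incrementCov_add_log_two_le`
(`|M·Cov(I_M, I_{M−1}) + log 2| ≤ 40/(M − 2)`): since `40/58 < log 2`, for every `M ≥ 60`
`Cov(I_M, I_{M−1}) = Ψ(log(M/(M−2))) − Ψ(log(M/(M−1))) − Ψ(log((M−1)/(M−2))) < 0`, i.e. `Ψ` is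
strictly SUBADDITIVE across consecutive log-integer lags from `M = 60` on (PIVOT-LAW §2a(iv):
correlation `≈ −log 2/log M`).  RH-FREE; nothing here bears on the truth of RH. [Suzuki2023, (1.1)]
-/

noncomputable section

-- D-0017: `Summit.<S>.<S>.…` is the designed namespace of a single-problem summit.
set_option linter.dupNamespace false

namespace Summit.RiemannHypothesis.RiemannHypothesis.Theorems.IntegerScrew

open Literature.NumberTheory.LFunctions

/-- **`Cov(I_M, I_{M−1}) < 0` for every `M ≥ 60`**: `Ψ(log(M/(M−2))) < Ψ(log(M/(M−1))) +
Ψ(log((M−1)/(M−2)))`. [folklore] -/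
theorem incrementCov_neg (M : ℕ) (hM : 60 ≤ M) :
    zetaScrew (Real.log ((M : ℝ) / ((M : ℝ) - 2)))
      - zetaScrew (Real.log ((M : ℝ) / ((M : ℝ) - 1)))
      - zetaScrew (Real.log (((M : ℝ) - 1) / ((M : ℝ) - 2))) < 0 := by
  have h := abs_incrementCov_add_log_two_le M (by omega)
  have hM' : (60 : ℝ) ≤ M := by exact_mod_cast hM
  have hM0 : (0 : ℝ) < M := by linarith
  have hm2 : (0 : ℝ) < (M : ℝ) - 2 := by linarith
  rw [abs_le] at h
  have hlog2 : (0.6931471803 : ℝ) < Real.log 2 := Real.log_two_gt_d9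
  have h40 : 40 / ((M : ℝ) - 2) ≤ 40 / 58 := by
    apply div_le_div_of_nonneg_left (by norm_num) (by norm_num) (by linarith)
  -- M·Cov ≤ −log 2 + 40/(M−2) < 0
  have hneg : (M : ℝ) * (zetaScrew (Real.log ((M : ℝ) / ((M : ℝ) - 2)))
      - zetaScrew (Real.log ((M : ℝ) / ((M : ℝ) - 1)))
      - zetaScrew (Real.log (((M : ℝ) - 1) / ((M : ℝ) - 2)))) < 0 := by
    have : (40 : ℝ) / 58 < Real.log 2 := by linarith
    linarith [h.2]
  by_contra hcon
  have hcon' := le_of_not_gt hcon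
  have := mul_nonneg hM0.le hcon'
  linarith

/-- The same in «triangle» form: `Ψ(h_M + h_{M−1}) < Ψ(h_M) + Ψ(h_{M−1})` for `M ≥ 60`, with
`h_M + h_{M−1} = log(M/(M−2))`. [folklore] -/
theorem zetaScrew_log_div_sub_two_lt (M : ℕ) (hM : 60 ≤ M) :
    zetaScrew (Real.log ((M : ℝ) / ((M : ℝ) - 2))) <
      zetaScrew (Real.log ((M : ℝ) / ((M : ℝ) - 1)))
        + zetaScrew (Real.log (((M : ℝ) - 1) / ((M : ℝ) - 2))) := by
  have := incrementCov_neg M hM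
  linarith

end Summit.RiemannHypothesis.RiemannHypothesis.Theorems.IntegerScrew
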